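import Summits.ValiantsHypothesis.ValiantsHypothesis.Theorems.KPlusLogSqLawTridiagonalRealStaticFourThirds
import Summits.ValiantsHypothesis.ValiantsHypothesis.Theorems.KPlusLogSqLawTridiagonalRealStaticTenFourteen

/-!
# Route «KPlusLogSqLaw», crux `WeakLifting` (stmt-ValiantsHypothesis-19561) — REAL side of the tridiagonal sector:
# the static definite tridiagonal real row is at least `⌊7m/5⌋ − 3` for EVERY `m ≥ 6` (kernel slope `7/5`; joint lift-p1 / lift-p3 row)

HONEST FRAMING.  Helper (`--supports stmt-ValiantsHypothesis-19561 --as helper`), seat val-sym-lift-p1 (g11), cell `pub-symmetroid`, 2026-08-27,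
in the typed currency of the desk's α target of record `staticTridiagonal_definite_posRoots_le` (lead R2102/R2114).  LOWER side only.  This file
is the `7/5` successor of `…TridiagonalRealStaticFourThirds` (`⌊4m/3⌋ − 2`, slope `4/3`): val-sym-lift-p3 g9's pump-and-harvest witness
`StaticTridiagonalRealPump.exists_static_definite_tridiagonal_ten_fourteen` (size `10`, FOURTEEN zeros, p572194) is the better block — each copy adds
exactly `14 = 7·10/5` — so the same gluing (`exists_glue_count`) now gives:
* `exists_static_definite_tridiagonal_sevenFifths` — for every `m ≥ 6` a static definite symmetric tridiagonal `m × m` monomial matrix whose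
  determinant has at least `⌊7m/5⌋ − 3` distinct positive zeros (`m = 6, …, 12`: the explicit witnesses of the two seats; `13 = 6+7`, `14 = 6+8`,
  `15 = 7+8`; `m ≥ 16`: `10 + (m − 10)`);
* `sevenFifths_le_of_definiteRow` — every admissible law `B` has `⌊7m/5⌋ − 3 ≤ B m` for all `m ≥ 6`;
* `sevenFifths_le_slope` — every real linear law `A·m + A₀` on the sector has `A ≥ 7/5`.
Located context (bus, 2026-08-27): lift-p3 g9's hierarchical LIMIT GAME gives `2m − 6` for even `m ≤ 18` (located) and is capped at `2m − 2` (paper),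
so the natural α row reads slope `2`; every further exact block of the pump (`m = 12 → 18`, …) raises the kernel slope of this gluing toward `2`.
Nothing here is an UPPER bound; nothing bears on `WeakLifting` / `TropicalB` (stmt-19771) in their windows, on Conjecture B, on the Door-A registers,
on `MatrixDescartes` (stmt-ValiantsHypothesis-18050) or on VP ≠ VNP.  [folklore: gluing; data of val-sym-lift-p1 g11 and val-sym-lift-p3 g9]
-/

-- `Summit.ValiantsHypothesis.ValiantsHypothesis.…` repeats a component by the D-0017 layout (single-conjunct summit); the name is mandated.
set_option linter.dupNamespace false
set_option autoImplicit false

namespace Summit.ValiantsHypothesis.ValiantsHypothesis.Theorems.KPlusLogSqLaw.StaticTridiagonalRealExcess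

open Polynomial Finset
open Summit.ValiantsHypothesis.ValiantsHypothesis.Theorems.KPlusLogSqLaw.StaticTridiagonalRealPump
  (exists_static_definite_tridiagonal_ten_fourteen)

/-- **THE STATIC DEFINITE TRIDIAGONAL REAL ROW IS AT LEAST `⌊7m/5⌋ − 3` FOR EVERY `m ≥ 6`** (kernel slope `7/5`): for every `m ≥ 6` there is a real
symmetric tridiagonal `m × m` matrix of monomials `c i j · X ^ (e i j)` with positive diagonal coefficients whose determinant has at least `⌊7m/5⌋ − 3`
distinct positive zeros.  Base `m = 6, …, 15` from the explicit witnesses (`7, 8, 10, 11, 14, 14, 16` at `6, …, 12`; `6+7 ↦ 15`, `6+8 ↦ 17`, `7+8 ↦ 18`),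
step `m = 10 + (m − 10)` with lift-p3's fourteen-zero block. [data of val-sym-lift-p1 g11 and val-sym-lift-p3 g9 + lift-p2's gluing] -/
theorem exists_static_definite_tridiagonal_sevenFifths (m : ℕ) (hm : 6 ≤ m) :
    ∃ (c : Fin m → Fin m → ℝ) (e : Fin m → Fin m → ℕ), (∀ i j, c i j = c j i) ∧ (∀ i j, e i j = e j i) ∧
      (∀ i j : Fin m, (i : ℕ) + 1 < j ∨ (j : ℕ) + 1 < i → c i j = 0) ∧ (∀ i, 0 < c i i) ∧
      7 * m / 5 - 3 ≤ ((Matrix.det (Matrix.of fun i j => C (c i j) * (X : ℝ[X]) ^ e i j)).roots.toFinset.filter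
        (fun t : ℝ => 0 < t)).card := by
  induction m using Nat.strong_induction_on with
  | _ m ih =>
    by_cases h16 : m < 16
    · interval_cases m
      · exact exists_witness_mono (by norm_num) exists_static_definite_tridiagonal_six_seven
      · exact exists_witness_mono (by norm_num) exists_static_definite_tridiagonal_seven_eight
      · exact exists_witness_mono (by norm_num) exists_static_definite_tridiagonal_eight10
      · exact exists_witness_mono (by norm_num) exists_static_definite_tridiagonal_nine_eleven
      · exact exists_witness_mono (by norm_num) exists_static_definite_tridiagonal_ten_fourteen
      · exact exists_witness_mono (by norm_num) exists_static_definite_tridiagonal_eleven14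
      · exact exists_witness_mono (by norm_num) exists_static_definite_tridiagonal_twelve16
      · exact exists_witness_mono (by norm_num) (exists_glue_count
          exists_static_definite_tridiagonal_six_seven exists_static_definite_tridiagonal_seven_eight (by norm_num) (by norm_num))
      · exact exists_witness_mono (by norm_num) (exists_glue_count
          exists_static_definite_tridiagonal_six_seven exists_static_definite_tridiagonal_eight10 (by norm_num) (by norm_num))
      · exact exists_witness_mono (by norm_num) (exists_glue_count
          exists_static_definite_tridiagonal_seven_eight exists_static_definite_tridiagonal_eight10 (by norm_num) (by norm_num))
    · have h6 : 6 ≤ m - 10 := by omega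
      have hlt : m - 10 < m := by omega
      have hsum : 10 + (m - 10) = m := by omega
      rw [← hsum]
      exact exists_witness_mono (by omega)
        (exists_glue_count exists_static_definite_tridiagonal_ten_fourteen (ih (m - 10) hlt h6) (by norm_num) (by omega))

/-- **Every admissible law on the sector has `⌊7m/5⌋ − 3 ≤ B m` for all `m ≥ 6`** (kernel slope `≥ 7/5`). [corollary] -/
theorem sevenFifths_le_of_definiteRow (B : ℕ → ℕ)
    (hB : ∀ (m : ℕ) (c : Fin m → Fin m → ℝ) (e : Fin m → Fin m → ℕ), (∀ i j, c i j = c j i) → (∀ i j, e i j = e j i) →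
        (∀ i j : Fin m, (i : ℕ) + 1 < j ∨ (j : ℕ) + 1 < i → c i j = 0) → (∀ i, 0 < c i i) →
        ((Matrix.det (Matrix.of fun i j => C (c i j) * (X : ℝ[X]) ^ e i j)).roots.toFinset.filter
          (fun t : ℝ => 0 < t)).card ≤ B m)
    (m : ℕ) (hm : 6 ≤ m) : 7 * m / 5 - 3 ≤ B m := by
  obtain ⟨c, e, hc, he, hband, hpos, hcard⟩ := exists_static_definite_tridiagonal_sevenFifths m hm
  exact hcard.trans (hB m c e hc he hband hpos)

/-- **Every real linear law `Z ≤ A·m + A₀` on the sector has `A ≥ 7/5`.** [corollary, Archimedean] -/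
theorem sevenFifths_le_slope (A A₀ : ℝ)
    (hB : ∀ (m : ℕ) (c : Fin m → Fin m → ℝ) (e : Fin m → Fin m → ℕ), (∀ i j, c i j = c j i) → (∀ i j, e i j = e j i) →
        (∀ i j : Fin m, (i : ℕ) + 1 < j ∨ (j : ℕ) + 1 < i → c i j = 0) → (∀ i, 0 < c i i) →
        (((Matrix.det (Matrix.of fun i j => C (c i j) * (X : ℝ[X]) ^ e i j)).roots.toFinset.filter
          (fun t : ℝ => 0 < t)).card : ℝ) ≤ A * m + A₀) :
    7 / 5 ≤ A := by
  by_contra hC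
  push Not at hC
  have key : ∀ m : ℕ, 6 ≤ m → (7 : ℝ) * m ≤ 5 * (A * m + A₀) + 20 := by
    intro m hm
    obtain ⟨c, e, hc, he, hband, hpos, hcard⟩ := exists_static_definite_tridiagonal_sevenFifths m hm
    have h1 := hB m c e hc he hband hpos
    have h2 : ((7 * m / 5 - 3 : ℕ) : ℝ) ≤ A * m + A₀ := le_trans (by exact_mod_cast hcard) h1
    have h3 : 7 * m ≤ 5 * (7 * m / 5 - 3) + 20 := by omega
    have h4 : ((7 * m : ℕ) : ℝ) ≤ ((5 * (7 * m / 5 - 3) + 20 : ℕ) : ℝ) := by exact_mod_cast h3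
    push_cast at h4
    linarith
  have hpos : 0 < 7 - 5 * A := by linarith
  obtain ⟨n, hn⟩ := exists_nat_gt ((5 * A₀ + 20) / (7 - 5 * A))
  have hk := key (n + 6) (by omega)
  have hcast : ((n + 6 : ℕ) : ℝ) = (n : ℝ) + 6 := by push_cast; ring
  rw [hcast] at hk
  have hlt : (5 * A₀ + 20) / (7 - 5 * A) < n := hn
  rw [div_lt_iff₀ hpos] at hlt
  nlinarith

end Summit.ValiantsHypothesis.ValiantsHypothesis.Theorems.KPlusLogSqLaw.StaticTridiagonalRealExcess
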